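import Literature.AnabelianGeometry.AbsoluteAnabelian.AbsTopIThm26ivProofs
import Literature.AnabelianGeometry.AbsoluteAnabelian.AbsTopIThm214GroupPartHolds
import HarnessLib

/-!
# [AbsTopI] Thm 2.14 (i) group part and [AbsTopII] Rmk 3.3.2 — the `Σ ≠ Primes` regime, via
# Thm 2.6 (iv)

S. Mochizuki, *Topics in Absolute Anabelian Geometry I: Generalities* (2012) [AbsTopI], Thm 2.6
(iv) p. 22 ("If, moreover, `Σ ≠ Primes`, then the kernel of the quotient `Π ↠ G` may be
characterized ["group-theoretically"] as the maximal almost pro-omissive topologically finitely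
generated closed normal subgroup of `Π`") and Thm 2.14 (i) p. 33 ("`p₁ = p₂` [...]; `φ` induces
isomorphisms `Δ₁ ⥲ Δ₂`, `G₁ ⥲ G₂`"); [AbsTopII] Rmk 3.3.2 p. 69 ("the subgroup `Δ ⊆ Π` admits a
purely 'group-theoretic' characterization [cf. [Mzk15], Theorem 2.6, (v), (vi)]").

The tree proves the group part of Thm 2.14 (i) and Rmk 3.3.2 in the two regimes typed by
abc-iut-L4-t4 — (v) (`Σ = Primes`, the `ζ`-characterization: `thm214GroupPart_of_thm26v`,
`rmk_3_3_2_of_thm26v`, abc-iut-L4-t6 / L4-t15) and (vi) (NF base).  This proof-only companion adds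
the complementary MLF regime `Σ ≠ Primes`, in which the characterization of `Δ` is the one of
Thm 2.6 (iv) (typed `FundamentalExtension.Thm26iv`), using the transport
`FundamentalExtension.preservesGeom_of_thm26iv` of `AbsTopIThm26ivProofs`:

* `AbsTopII.rmk_3_3_2_of_thm26iv` — Rmk 3.3.2 on the class of extensions satisfying the typed
  Thm 2.6 (iv) for some `Σ ≠ Primes`;
* `FundamentalExtension.thm214GroupPart_of_thm26iv` — `Thm214GroupPart B₁ B₂ φ` for EVERY
  `φ : Π₁ ⥲ Π₂` between such extensions with MLF base data (the residue characteristics via the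
  tree's [AbsAnab] Prop 1.2.1 (i)), and the induced bicontinuous `G₁ ⥲ G₂`;
* `FundamentalExtension.MLFBase.thm214GroupPart_of_isElastic_gal` — the same with the (iv)
  hypothesis DISCHARGED down to: elasticity of `G₁`, `G₂` ([AbsTopI] Thm 1.7 (ii), carried as
  `IsElastic`; GAP-LEDGER G-w5d206-1), `Δᵢ` topologically finitely generated (Prop 2.2 BY NAME,
  `GeomTFG`) and pro-`Σᵢ` with `Σᵢ ⊊ Primes`.

HONEST FRAMING: reductions inside refereed, undisputed papers; the deep inputs (elasticity of
`G_k`; the pro-`Σ`/finite-generation data of `Δ`, geometric in print) stay hypotheses.  Nothing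
here bears on [IUTchIII] Cor 3.12; typed ≠ proved for those inputs.
-/

noncomputable section

namespace Literature.AnabelianGeometry.AbsoluteAnabelian

universe u

/-- **[AbsTopII] Rmk 3.3.2 in the regime of [AbsTopI] Thm 2.6 (iv)**: on the class of extensions
`1 → Δ → Π → G → 1` satisfying the typed Thm 2.6 (iv) for some `Σ ≠ Primes` (so that `Δ` is the
maximal almost pro-omissive topologically finitely generated closed normal subgroup of `Π`),
every isomorphism of the profinite groups `Π` of two members carries `Δ` onto `Δ`.
[cite: MochizukiAbsTopII2013, Rmk 3.3.2 p.69] -/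
theorem AbsTopII.rmk_3_3_2_of_thm26iv :
    AbsTopII.Rmk_3_3_2
      {E : FundamentalExtension.{u} | ∃ S : Set ℕ, S ≠ {q | q.Prime} ∧ E.Thm26iv S} := by
  intro E hE F hF φ
  obtain ⟨S, hS, hES⟩ := hE
  obtain ⟨T, hT, hFT⟩ := hF
  exact FundamentalExtension.preservesGeom_of_thm26iv hES hS hFT hT φ

namespace FundamentalExtension

variable {E F : FundamentalExtension.{0}}

/-- **[AbsTopI] Thm 2.14 (i), group-theoretic part, in the regime `Σ ≠ Primes`** (relative to the
typed Thm 2.6 (iv) on both sides): for extensions with MLF base data satisfying `Thm26iv` with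
`Σ₁, Σ₂ ≠ Primes`, EVERY isomorphism of profinite groups `φ : Π₁ ⥲ Π₂` satisfies
`Thm214GroupPart B₁ B₂ φ` — "`p₁ = p₂`" (the tree's [AbsAnab] Prop 1.2.1 (i)), `φ(Δ₁) = Δ₂`, and
equal minimal almost-pro sets. [cite: MochizukiAbsTopI2012, Thm 2.14 (i) p.33] -/
theorem thm214GroupPart_of_thm26iv {B₁ : E.MLFBase} {B₂ : F.MLFBase} {S T : Set ℕ}
    (h₁ : E.Thm26iv S) (hS : S ≠ {q | q.Prime}) (h₂ : F.Thm26iv T) (hT : T ≠ {q | q.Prime})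
    (φ : E.arith ≃ₜ* F.arith) : Thm214GroupPart B₁ B₂ φ :=
  (preservesGeom_of_thm26iv h₁ hS h₂ hT φ).thm214GroupPart B₁ B₂

/-- "`p₁ = p₂`" of Thm 2.14 (i) for an ARBITRARY `φ : Π₁ ⥲ Π₂` between extensions in the
Thm 2.6 (iv) regime (`Σᵢ ≠ Primes`). [cite: MochizukiAbsTopI2012, Thm 2.14 (i) p.33] -/
theorem residueChar_eq_of_thm26iv {B₁ : E.MLFBase} {B₂ : F.MLFBase} {S T : Set ℕ}
    (h₁ : E.Thm26iv S) (hS : S ≠ {q | q.Prime}) (h₂ : F.Thm26iv T) (hT : T ≠ {q | q.Prime})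
    (φ : E.arith ≃ₜ* F.arith) : B₁.p = B₂.p :=
  (thm214GroupPart_of_thm26iv (B₁ := B₁) (B₂ := B₂) h₁ hS h₂ hT φ).1

/-- The induced bicontinuous `G₁ ⥲ G₂` of Thm 2.14 (i), compatible with the augmentations, in the
Thm 2.6 (iv) regime. [cite: MochizukiAbsTopI2012, Thm 2.14 (i) p.33] -/
theorem exists_continuousMulEquiv_gal_of_thm26iv {S T : Set ℕ}
    (h₁ : E.Thm26iv S) (hS : S ≠ {q | q.Prime}) (h₂ : F.Thm26iv T) (hT : T ≠ {q | q.Prime})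
    (φ : E.arith ≃ₜ* F.arith) :
    ∃ β : E.gal ≃ₜ* F.gal, ∀ x : E.arith, β (E.aug x) = F.aug (φ x) :=
  (preservesGeom_of_thm26iv h₁ hS h₂ hT φ).exists_continuousMulEquiv_gal

/-- **[AbsTopI] Thm 2.14 (i), group part, `Σ ≠ Primes` regime, down to the printed inputs of
Thm 2.6 (iv)**: for extensions with MLF base data, ELASTIC `G₁`, `G₂` ([AbsTopI] Thm 1.7 (ii)),
and topologically finitely generated (Prop 2.2, `GeomTFG`) pro-`Σᵢ` geometric groups with
`Σᵢ ⊊ Primes`, every `φ : Π₁ ⥲ Π₂` satisfies `Thm214GroupPart B₁ B₂ φ`.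
[cite: MochizukiAbsTopI2012, Thm 2.14 (i) p.33] -/
theorem MLFBase.thm214GroupPart_of_isElastic_gal (B₁ : E.MLFBase) (B₂ : F.MLFBase)
    (hG₁ : IsElastic E.gal) (hG₂ : IsElastic F.gal) (hΔ₁ : E.GeomTFG) (hΔ₂ : F.GeomTFG)
    {S T : Set ℕ} (hS : S ⊆ {q | q.Prime}) (hS' : S ≠ {q | q.Prime}) (hES : IsProSet E.geom S)
    (hT : T ⊆ {q | q.Prime}) (hT' : T ≠ {q | q.Prime}) (hFT : IsProSet F.geom T)
    (φ : E.arith ≃ₜ* F.arith) : Thm214GroupPart B₁ B₂ φ :=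
  (MLFBase.preservesGeom_of_isElastic_gal B₁ B₂ hG₁ hG₂ hΔ₁ hΔ₂ hS hS' hES hT hT' hFT
    φ).thm214GroupPart B₁ B₂

/-- Under the same inputs: the induced bicontinuous `G₁ ⥲ G₂` compatible with the augmentations.
[cite: MochizukiAbsTopI2012, Thm 2.14 (i) p.33] -/
theorem MLFBase.exists_continuousMulEquiv_gal_of_isElastic_gal (B₁ : E.MLFBase)
    (B₂ : F.MLFBase) (hG₁ : IsElastic E.gal) (hG₂ : IsElastic F.gal) (hΔ₁ : E.GeomTFG)
    (hΔ₂ : F.GeomTFG) {S T : Set ℕ} (hS : S ⊆ {q | q.Prime}) (hS' : S ≠ {q | q.Prime})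
    (hES : IsProSet E.geom S) (hT : T ⊆ {q | q.Prime}) (hT' : T ≠ {q | q.Prime})
    (hFT : IsProSet F.geom T) (φ : E.arith ≃ₜ* F.arith) :
    ∃ β : E.gal ≃ₜ* F.gal, ∀ x : E.arith, β (E.aug x) = F.aug (φ x) :=
  (MLFBase.preservesGeom_of_isElastic_gal B₁ B₂ hG₁ hG₂ hΔ₁ hΔ₂ hS hS' hES hT hT' hFT
    φ).exists_continuousMulEquiv_gal

end FundamentalExtension

end Literature.AnabelianGeometry.AbsoluteAnabelian

end
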